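import Literature.Probability.LatticeModels.HighDimTrivialityPanisFourProofs
import Literature.Probability.LatticeModels.ImprovedTreeDiagramBoundHolds
import HarnessLib

/-!
# High-dimensional triviality of Ising scaling limits: discharge of Panis's `d = 4` bound

Topic `Literature/Probability/LatticeModels`; family `crit-ising`. Discharges the named fact
`panis_ursellFourSum_le_four` (`HighDimTrivialityUniform.lean`; R. Panis, *Triviality of the scaling limits of
critical Ising and φ⁴ models with effective dimension at least four*, Ann. Probab. 54 (2026) = arXiv:2309.05797,
Cor. 1.8 and its proof, §6.6 p. 33) by combining

* the tree's reduction `panis_ursellFourSum_le_four_of_improvedTreeDiagramBound`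
  (`HighDimTrivialityPanisFourProofs.lean`: Fekete bound on the axis two-point function, the `φ_β`-window of
  Panis Def. 3.21 / Rem. 3.22 ⇒ the Aizenman–Duminil-Copin correlation-length window at scale `L^{1/4}`,
  bubble-diagram growth (Panis Lemma 6.16, nearest-neighbour case) and the four-sum bookkeeping of
  Aizenman–Duminil-Copin 2021 §6.3), with
* the discharge `aizenmanDuminilCopin_improvedTreeDiagramBound_holds` of Aizenman–Duminil-Copin 2021, Thm 1.3
  (`ImprovedTreeDiagramBoundHolds.lean`).

Separate leaf file: `HighDimTrivialityUniform(Proofs).lean` are imported by `ImprovedTreeDiagramBound.lean` and hence by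
the whole random-current chain below `ImprovedTreeDiagramBoundHolds.lean` (an append there would close an import cycle).

## References
* R. Panis, arXiv:2309.05797 (Ann. Probab. 54, 2026), Cor. 1.8 (p. 8), §6.6 (p. 33), Def. 3.21, Rem. 3.22 (p. 16),
  Lemma 6.16 (p. 27) [Panis2023Triviality].
* M. Aizenman, H. Duminil-Copin, *Marginal triviality of the scaling limits of critical 4D Ising and φ⁴₄ models*,
  Ann. of Math. 194 (2021), arXiv:1912.07973, Thm 1.3 (p. 6), §6.3 (pp. 26–27) [AizenmanDuminilCopinAnnals2021].
-/

namespace Literature.Probability.LatticeModels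

/-- **Panis 2023, Cor. 1.8 (`d = 4`, sharp-length window) — discharged**: the named fact
`panis_ursellFourSum_le_four` holds, from the reduction to Aizenman–Duminil-Copin 2021, Thm 1.3
(`panis_ursellFourSum_le_four_of_improvedTreeDiagramBound`) and the discharge of that theorem
(`aizenmanDuminilCopin_improvedTreeDiagramBound_holds`).
[cite: Panis2023Triviality, Cor. 1.8 (p. 8) and its proof §6.6 (p. 33)]
[cite: AizenmanDuminilCopinAnnals2021, arXiv:1912.07973 Thm 1.3 (p. 6), §6.3 (pp. 26–27)] -/
theorem panis_ursellFourSum_le_four_holds : panis_ursellFourSum_le_four :=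
  panis_ursellFourSum_le_four_of_improvedTreeDiagramBound aizenmanDuminilCopin_improvedTreeDiagramBound_holds

end Literature.Probability.LatticeModels
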